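import Summits.NavierStokesRegularity.FluidComputer.PalasekTowerGermHostSuperposedFreeRunAt
import Summits.NavierStokesRegularity.FluidComputer.PalasekTowerGermHostFreeRunAt
import Summits.NavierStokesRegularity.FluidComputer.PalasekTowerTameCarrierAtRun
import Summits.NavierStokesRegularity.FluidComputer.PalasekTowerStrainDoorAtRaw

/-!
# The germ host AT ARBITRARY RATES `R` — THE LEVEL-`1` MECHANISM DOOR AT `R` INHABITED: at every
# register-admissible `R`, ONE free run of a mechanism datum ALONE gives `EpisodeBaseGAt R`
# (layer L4c-iii, the end of the door port; `StrainDoor.MechanismDoorAt R` by name)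

Cell `ns-blowup`, seat `ns-blowup-ecbridge-3` (g9; D-0074 GROUP C «BRIDGE SUPPORT», lineage
`host_preparation`). Route `PalasekTowerBreakdown` after the RE-BASE (rev 19): live crux
`EpisodeBaseT := EpisodeBaseGAt TowerRates.tuned` (stmt-NavierStokesRegularity-20303), LEAD line `straindoor`
(skeleton v3, ns-palasek-20303-p1) with the two registered stubs `stub_mechanism_doorT :
StrainDoor.MechanismDoorAt TowerRates.tuned` and `stub_raw_certificateT : StrainDoor.RawCertificateAt
TowerRates.tuned`. LABEL: E–C typing (KERNEL: theorems only; no definition, no named fact, no `sorry`).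
WHAT THIS IS NOT: not Navier–Stokes evidence — no free run meeting the first-window letter of any register
is exhibited; `EpisodeBaseGAt R` appears only as the conclusion of conditionals / inside the `Prop`
`MechanismDoorAt R`; nothing about `RungG 1` or blow-up is asserted.

## The result

The `R`-generic twin of the landed wide chain p512842 → p523959 (`…episodeBase_of_superposed_freeRuns`,
`…episodeBase_of_mechanism_freeRun`), assembled from the `R`-generic layers of the door port: the
superposition door at `R` (`LevelZeroDataAt.exists_superposed_freeRun`, L4c-ii), the free-run door at `R`
(`LevelZeroDataAt.episodeBaseGAt_of_freeRun`, L4b, p532583) and the tame-carrier run at `R`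
(`exists_levelZeroDataAt_tame_freeRun_cap`, L3, p529339: Kato small data + Leray short time):

* `LevelZeroDataAt.episodeBaseGAt_of_superposed_freeRuns` — at a register-admissible `R`
  (`hR : R.BoxNumerics c₃ r`), a strict-slot carrier at `R` with a free run under the cap AND an amplifier
  whose own free run meets the letter of `R` ⟹ `EpisodeBaseGAt R`;
* `margin_le_third_at` — the letter forces `η ≤ Y₁(R)/3`;
* **`mechanismDoorAt_of_boxNumerics : R.BoxNumerics c₃ r → StrainDoor.MechanismDoorAt R`** — THE
  MECHANISM DOOR AT `R`: the carrier half is supplied by the tame carrier at `R` under the cap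
  (`2Y₀(R) ≤ Y₁(R)` is `hR.sep 0`), so ONE free run of a speed-`< Y₀(R)` smooth compactly supported
  divergence-free datum meeting the four faces of `R` closes `EpisodeBaseGAt R`;
* `exists_hostPreparation_of_boxNumerics` — the level-`0` rung at `R` (∃ pinned rigid quiet schedule with a
  registered level-`0` stage: the `birth` line's `stub_host_preparationT` at `R = tuned`), from the tame carrier;
* `episodeBaseGAt_of_boxNumerics_of_certificateAt` / `…_of_certificateSharpAt` / `…_of_rawCertificateAt` —
  composed with the LEAD's strain doors (p528856 / p530553 / p531699): at every register-admissible `R`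
  the crux `EpisodeBaseGAt R` is EXACTLY one strain certificate (classical / numeral / RAW letter).

At `R = TowerRates.tuned` (`TowerRates.tuned_boxNumerics`) this discharges `stub_mechanism_doorT` and leaves
the crux `EpisodeBaseT` equal to its ONE computation stub `RawCertificateAt tuned` (by-name statements in
`Theorems/PalasekTowerBreakdownEpisodeBaseTMechanismFreeRun`). References: S. Palasek, arXiv:2605.13827 §4
[cite: Palasek2026ElementaryModel, §4]; T. Kato, Math. Z. 187 (1984), Thm. 2–4 [cite: Kato1984, Thm. 2–4];
T. Tao, Anal. PDE 6 (2013), Thm. 5.4 [cite: Tao2011, Thm. 5.4 (ii)+(iv)]; M. Dashti, J. C. Robinson, SIAM J.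
Numer. Anal. 46 (2008), Thm. 5 [cite: DashtiRobinson2008, Thm. 5].
-/

noncomputable section

namespace Summit.NavierStokesRegularity.FluidComputer.PalasekTowerClayBridge.Germ

open Set Function Filter Topology InnerProductSpace Metric MeasureTheory
open scoped Topology ContDiff RealInnerProductSpace ENNReal NNReal
open Literature.Analysis Literature.Analysis.FluidPDE

variable {R : TowerRates}

/-! ## §1 Two free runs at `R` ⟹ `EpisodeBaseGAt R` -/

/-- **`EpisodeBaseGAt R` FROM A CARRIER RUN AND AN AMPLIFIER RUN AT THE RATES `R` (dynamic companion rule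
at `R`).** At a register-admissible `R` (`hR : R.BoxNumerics c₃ r`): a strict-slot carrier
`h₁ : LevelZeroDataAt R U₁ ρ₁` with ONE classical finite-energy free run (`ν = 1`) on `[1, τfirstAt R]` from
`U₁` below `(5/3) Y₁(R) − η`, and a smooth divergence-free `W` with `tsupport W ⊆ B̄(0, ρ₂)` (`ρ₂ ≥ 0`), speed
`< Y₀(R)`, with ONE classical finite-energy free run on `[1, τfirstAt R]` from `W` below `(5/3) Y₁(R) − η`
showing at `τfirstAt R`, inside `‖x‖ ≤ ρ₂`, the speed `Y₁(R) + η`, the gradient `A₁(R) + η` and an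
`N₁(R)`-core loop of circulation `≥ N₁(R)^{β−2} + η` (`η > 0`) ⟹ `EpisodeBaseGAt R` (far enough apart the
composite is a strict-slot filler at `R` whose free run meets the letter with margin `η/2`,
`LevelZeroDataAt.exists_superposed_freeRun`; then the free-run door at `R`).
[cite: Palasek2026ElementaryModel, §4] [cite: Tao2011, Thm. 5.4 (ii)+(iv)] -/
theorem LevelZeroDataAt.episodeBaseGAt_of_superposed_freeRuns
    {U₁ W : EuclideanSpace ℝ (Fin 3) → EuclideanSpace ℝ (Fin 3)} {ρ₁ ρ₂ : ℝ} (h₁ : LevelZeroDataAt R U₁ ρ₁)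
    {c₃ r : ℝ} (hR : R.BoxNumerics c₃ r)
    (hW : ContDiff ℝ ∞ W) (hdivW : VectorCalculus.IsDivFree W) (hWsupp : tsupport W ⊆ closedBall 0 ρ₂)
    (hWlt : ∀ x, ‖W x‖ < R.Y 0) (hρ₂ : 0 ≤ ρ₂)
    {v₁ : ℝ → EuclideanSpace ℝ (Fin 3) → EuclideanSpace ℝ (Fin 3)} {q₁ : ℝ → EuclideanSpace ℝ (Fin 3) → ℝ}
    (hv₁ : IsClassicalNSSolutionOn (Icc 1 (Host.τfirstAt R)) 1 0 v₁ q₁) (hv₁1 : v₁ 1 = U₁)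
    (hv₁E : ∃ C : ℝ≥0∞, C < ⊤ ∧ ∀ t ∈ Icc (1 : ℝ) (Host.τfirstAt R), ∫⁻ x, ‖v₁ t x‖ₑ ^ 2 ≤ C)
    {v₂ : ℝ → EuclideanSpace ℝ (Fin 3) → EuclideanSpace ℝ (Fin 3)} {q₂ : ℝ → EuclideanSpace ℝ (Fin 3) → ℝ}
    (hv₂ : IsClassicalNSSolutionOn (Icc 1 (Host.τfirstAt R)) 1 0 v₂ q₂) (hv₂1 : v₂ 1 = W)
    (hv₂E : ∃ C : ℝ≥0∞, C < ⊤ ∧ ∀ t ∈ Icc (1 : ℝ) (Host.τfirstAt R), ∫⁻ x, ‖v₂ t x‖ₑ ^ 2 ≤ C)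
    {η : ℝ} (hη : 0 < η)
    (hcap₁ : ∀ t ∈ Icc (1 : ℝ) (Host.τfirstAt R), ∀ x, ‖v₁ t x‖ ≤ 5 / 3 * R.Y 1 - η)
    (hcap₂ : ∀ t ∈ Icc (1 : ℝ) (Host.τfirstAt R), ∀ x, ‖v₂ t x‖ ≤ 5 / 3 * R.Y 1 - η)
    (hspeed : ∃ x, ‖x‖ ≤ ρ₂ ∧ R.Y 1 + η ≤ ‖v₂ (Host.τfirstAt R) x‖)
    (hstrain : ∃ x, ‖x‖ ≤ ρ₂ ∧ R.A 1 + η ≤ ‖fderiv ℝ (v₂ (Host.τfirstAt R)) x‖)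
    (hcore : ∃ (x : EuclideanSpace ℝ (Fin 3)) (γ : ℝ → EuclideanSpace ℝ (Fin 3)),
      ‖x‖ ≤ ρ₂ ∧ ContDiff ℝ 1 γ ∧ γ 0 = γ 1 ∧
      (∀ s ∈ Icc (0 : ℝ) 1, γ s ∈ closedBall x (1 / R.N 1)) ∧
      (∀ s ∈ Icc (0 : ℝ) 1, ‖deriv γ s‖ ≤ 8 * Real.pi / R.N 1) ∧
      R.N 1 ^ (R.β - 2) + η ≤ circulation (v₂ (Host.τfirstAt R)) γ) :
    EpisodeBaseGAt R := by
  obtain ⟨r₀, hr₀⟩ := h₁.exists_superposed_freeRun hW hdivW hWsupp hWlt hρ₂ hv₁ hv₁1 hv₁E hv₂ hv₂1 hv₂E hη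
    hcap₁ hcap₂ hspeed hstrain hcore
  -- a translation vector of length `≥ r₀`
  obtain ⟨c, hc'⟩ := exists_norm_eq (EuclideanSpace ℝ (Fin 3)) (le_max_right r₀ 0)
  have hc : r₀ ≤ ‖c‖ := by rw [hc']; exact le_max_left _ _
  obtain ⟨hLZ, u, p, hu, hu1, huE, hcap, hsp, hst, hco⟩ := hr₀ c hc
  exact hLZ.episodeBaseGAt_of_freeRun hR hu hu1 huE (half_pos hη) hcap hsp hst hco

/-! ## §2 The mechanism door at `R` -/

/-- A free run reaching the speed `Y₁(R) + η` under the cap `(5/3) Y₁(R) − η` has `η ≤ Y₁(R)/3`.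
[folklore] -/
theorem margin_le_third_at {η ρ : ℝ} {w : EuclideanSpace ℝ (Fin 3) → EuclideanSpace ℝ (Fin 3)}
    (hspeed : ∃ x, ‖x‖ ≤ ρ ∧ R.Y 1 + η ≤ ‖w x‖) (hcap : ∀ x, ‖w x‖ ≤ 5 / 3 * R.Y 1 - η) :
    η ≤ R.Y 1 / 3 := by
  obtain ⟨x, -, hx⟩ := hspeed
  have := hcap x
  linarith

/-- **THE LEVEL-`1` MECHANISM DOOR AT EVERY REGISTER-ADMISSIBLE `R`** (`StrainDoor.MechanismDoorAt R` by
name, the registered statement of the stub `stub_mechanism_doorT` at `R = tuned`): for every smooth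
divergence-free `W` with `tsupport W ⊆ B̄(0, ρ)` (`ρ ≥ 0`) of speed `< Y₀(R)` and every classical
finite-energy FREE run on `[1, τfirstAt R]` from `W` below `(5/3) Y₁(R) − η` (`η > 0`) showing at
`τfirstAt R`, inside `‖x‖ ≤ ρ`, the speed `Y₁(R) + η`, the gradient `A₁(R) + η` and an `N₁(R)`-core loop of
circulation `≥ N₁(R)^{β−2} + η` — `EpisodeBaseGAt R`. Proof: `η ≤ Y₁(R)/3` (`margin_le_third_at`); a tame
carrier at `R` with a classical free run under the cap exists (`exists_levelZeroDataAt_tame_freeRun_cap`,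
band `2Y₀(R) ≤ Y₁(R)` from `hR.sep 0`); the superposition door at `R` and the free-run door at `R` close.
[cite: Palasek2026ElementaryModel, §4] [cite: Kato1984, Thm. 2–4] [cite: Tao2011, Thm. 5.4 (ii)+(iv)] -/
theorem mechanismDoorAt_of_boxNumerics {c₃ r : ℝ} (hR : R.BoxNumerics c₃ r) :
    StrainDoor.MechanismDoorAt R := by
  intro W ρ hW hdivW hWsupp hWlt hρ v₂ q₂ hv₂ hv₂1 hv₂E η hη hcap₂ hspeed hstrain hcore
  have hτ : Host.τfirstAt R ∈ Icc (1 : ℝ) (Host.τfirstAt R) := ⟨(Host.one_lt_τfirstAt R).le, le_rfl⟩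
  have hη3 : η ≤ R.Y 1 / 3 := margin_le_third_at hspeed (hcap₂ (Host.τfirstAt R) hτ)
  obtain ⟨U, hLZ, v, q, hv, hv1, hE, hcap₁⟩ := exists_levelZeroDataAt_tame_freeRun_cap (hR.sep 0) hη3
  exact hLZ.episodeBaseGAt_of_superposed_freeRuns hR hW hdivW hWsupp hWlt hρ hv hv1 hE hv₂ hv₂1 hv₂E hη
    hcap₁ hcap₂ hspeed hstrain hcore

/-! ## §3 Composed with the strain doors: the crux at `R` is one certificate -/

/-- **`EpisodeBaseGAt R` ⟸ ONE STRAIN CERTIFICATE at a register-admissible `R`** (classical letter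
`StrainDoor.CertificateAt R`, p528856; the mechanism door is `mechanismDoorAt_of_boxNumerics`).
[cite: Palasek2026ElementaryModel, §4] [cite: DashtiRobinson2008, Thm. 5] -/
theorem episodeBaseGAt_of_boxNumerics_of_certificateAt {c₃ r : ℝ} (hR : R.BoxNumerics c₃ r)
    (hcert : StrainDoor.CertificateAt R) : EpisodeBaseGAt R :=
  StrainDoor.episodeBaseGAt_of_mechanismDoorAt_of_certificateAt (mechanismDoorAt_of_boxNumerics hR) hcert

/-- **`EpisodeBaseGAt R` ⟸ ONE NUMERAL STRAIN CERTIFICATE at a register-admissible `R`** (numeral letter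
`StrainDoor.CertificateSharpAt R`, p530553). [cite: Palasek2026ElementaryModel, §4]
[cite: DashtiRobinson2008, Thm. 5] -/
theorem episodeBaseGAt_of_boxNumerics_of_certificateSharpAt {c₃ r : ℝ} (hR : R.BoxNumerics c₃ r)
    (hcert : StrainDoor.CertificateSharpAt R) : EpisodeBaseGAt R :=
  StrainDoor.episodeBaseGAt_of_mechanismDoorAt_of_certificateSharpAt (mechanismDoorAt_of_boxNumerics hR)
    hcert

/-- **`EpisodeBaseGAt R` ⟸ ONE RAW STRAIN CERTIFICATE at a register-admissible `R`** (RAW letter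
`StrainDoor.RawCertificateAt R`, p531699 — the statement a computation checks).
[cite: Palasek2026ElementaryModel, §4] [cite: DashtiRobinson2008, Thm. 5] -/
theorem episodeBaseGAt_of_boxNumerics_of_rawCertificateAt {c₃ r : ℝ} (hR : R.BoxNumerics c₃ r)
    (hcert : StrainDoor.RawCertificateAt R) : EpisodeBaseGAt R :=
  StrainDoor.episodeBaseGAt_of_mechanismDoorAt_of_rawCertificateAt (mechanismDoorAt_of_boxNumerics hR) hcert

/-! ## §4 Host preparation at every register-admissible `R` (the `birth` line's first stub, ∃-form) -/

/-- **HOST PREPARATION AT EVERY REGISTER-ADMISSIBLE `R`** (the level-`0` rung at `R`; the ∃-form statement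
`HostPreparationT` of the stub `stub_host_preparationT` of the fallback line `birth` at `R = tuned`): some
pinned (`Λ = 8`, `θ = 6/5`), rigid, quiet schedule on the rates `R` carries a globally anchored registered
stage at LEVEL `0` — the germ schedule of a tame carrier (`exists_levelZeroDataAt_small`,
`LevelZeroDataAt.stage`, push `c₄ = 1`). [cite: Palasek2026ElementaryModel, §3.3] -/
theorem exists_hostPreparation_of_boxNumerics {c₃ r : ℝ} (hR : R.BoxNumerics c₃ r) :
    ∃ S : Schedule R, S.Pins 8 (6 / 5) ∧ S.Rigid ∧ S.Quiet ∧ Nonempty (Stage 1 R S (Margins.routeG R) 0) := by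
  obtain ⟨U, hLZ, -⟩ := exists_levelZeroDataAt_small R 1 one_pos
  exact ⟨hLZ.schedule hR 1 one_pos le_rfl, hLZ.schedule_pins hR one_pos le_rfl,
    hLZ.schedule_rigid hR one_pos le_rfl, hLZ.schedule_quiet hR one_pos le_rfl, hLZ.stage hR one_pos le_rfl⟩

end Summit.NavierStokesRegularity.FluidComputer.PalasekTowerClayBridge.Germ

end
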